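import Literature.Analysis.FluidPDE.TaoEnstrophyLocalisationProofs
import Literature.Analysis.FluidPDE.SolenoidalTruncation
import Literature.Analysis.FluidPDE.HessianLaplacian
import Literature.Analysis.FluidPDE.MildSolutionProofs
import HarnessLib

/-!
# The `div`–`curl` energy estimate for divergence-free fields in `L² + L⁴` (dimension `3`)

Analysis/FluidPDE support file in the decomposition of `Literature.Analysis.FluidPDE.galdi_energy_equality`
(Galdi 2018, Thm. 1.1: a very weak `L⁴(0,T; L⁴)` solution of Navier–Stokes lies in the
Leray–Hopf class), step "vorticity in `L²` ⇒ gradient in `L²`". For a **smooth**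
divergence-free field `v` on a `3`-dimensional real inner product space `E` one has the
pointwise algebra `|Dv|² = tr (Dv ∘ Dv) + ½ |Dv − Dvᵀ|²` and, after two integrations by parts,
`∫ χ tr (Dv ∘ Dv) = -∫ Dχ ((v·∇)v) = ∫ Σᵢⱼ (∂ⱼ∂ᵢχ) vᵢ vⱼ` for every cut-off `χ ∈ C_c²`; with the
accepted radial cut-offs `χ_R` (`Fluid.cutoff`, `‖D²χ_R‖ ≤ C/R²` supported in `|x| ≤ 2R`) the error
is `O(R⁻² ∫_{|x|≤2R} |v|²) = O(R^{-1/2})` as soon as `v ∈ L² + L⁴` (Hölder; this is where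
`dim E = 3` enters), whence `∫ |Dv|² ≤ ½ ∫ |Dv − Dvᵀ|²` — with **no** a priori integrability of
`Dv` and no `L²` assumption on `v` itself (the accepted
`Fluid.lintegral_frobeniusNormSq_fderiv_le_lintegral_sq_norm_curl`,
`FluidPDE/TaoEnstrophyLocalisationProofs`, is the `L²` case on `ℝ³` with the curl vector; here the
antisymmetric part is written in an arbitrary orthonormal frame `b`,
`½ Σᵢⱼ (⟪Dv bᵢ, bⱼ⟫ − ⟪Dv bⱼ, bᵢ⟫)²`, the form produced by the vorticity-duality argument
`FluidPDE/NSVorticityL2`). Classical (Sohr 2001, Ch. II, Lemma 1.1.3-type estimates via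
`-Δ = curl curl − ∇ div`; Galdi 2011, §II.6 / III.1 for the whole-space `div`–`curl` identity).

## Main results (all proved)

* `Fluid.frobeniusNormSq_eq_trace_comp_add_half_sum`: the pointwise identity
  `|L|²_F = tr (L ∘ L) + ½ Σᵢⱼ (⟪L bᵢ, bⱼ⟫ − ⟪L bⱼ, bᵢ⟫)²` for `L : E →L[ℝ] E`.
* `Fluid.integral_fderiv_apply_fderiv_self_eq`: `∫ Dψ ((v·∇)v) = -∫ Σᵢⱼ (D²ψ bⱼ bᵢ) vᵢ vⱼ` for
  `C²` divergence-free `v` and `ψ ∈ C_c²`.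
* `Fluid.lintegral_ofReal_le_of_forall_integral_cutoff_mul_le`: exhaustion with an `o(1)` error.
* `Fluid.lintegral_frobeniusNormSq_fderiv_le_of_memLp_two_add_four`: for `finrank ℝ E = 3`,
  `v ∈ C²` divergence free with `v = h + k`, `h ∈ L²`, `k ∈ L⁴`:
  `∫⁻ |Dv|²_F ≤ ∫⁻ ½ Σᵢⱼ (⟪Dv bᵢ, bⱼ⟫ − ⟪Dv bⱼ, bᵢ⟫)²` in `[0, ∞]`.

## References

* H. Sohr, *The Navier–Stokes Equations*, Birkhäuser 2001, Ch. IV–V (energy class) (`Sohr2001`).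
* G. P. Galdi, *On the energy equality for distributional solutions to Navier–Stokes
  equations*, Proc. AMS 147 (2019) 785–792, proof of Thm. 1.1 (`Galdi2018`; the fact served).
-/

noncomputable section

open MeasureTheory TopologicalSpace Set Function Filter Topology InnerProductSpace Module Metric
open scoped RealInnerProductSpace ENNReal NNReal ContDiff

namespace Literature.Analysis.FluidPDE

variable {E : Type*} [NormedAddCommGroup E] [InnerProductSpace ℝ E] [FiniteDimensional ℝ E]
variable {ι : Type*} [Fintype ι]

/-! ### Pointwise algebra: `|L|² = tr (L ∘ L) + ½ |L − Lᵀ|²` in an orthonormal frame -/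

section Algebra

omit [FiniteDimensional ℝ E] in
/-- `⟪bᵢ, L (L bᵢ)⟫ = Σⱼ ⟪L bᵢ, bⱼ⟫ ⟪L bⱼ, bᵢ⟫` (expand `L bᵢ` in the frame). [folklore] -/
theorem inner_apply_apply_eq_sum (b : OrthonormalBasis ι ℝ E) (L : E →L[ℝ] E) (i : ι) :
    ⟪b i, L (L (b i))⟫ = ∑ j, ⟪L (b i), b j⟫ * ⟪L (b j), b i⟫ := by
  conv_lhs => rw [← b.sum_repr' (L (b i)), map_sum, inner_sum]
  refine Finset.sum_congr rfl fun j _ => ?_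
  rw [map_smul, inner_smul_right, real_inner_comm (b j), real_inner_comm (b i)]

/-- A double-sum identity: `Σᵢⱼ xᵢⱼ² = Σᵢⱼ xᵢⱼ xⱼᵢ + ½ Σᵢⱼ (xᵢⱼ − xⱼᵢ)²`. [folklore] -/
theorem sum_sum_sq_eq_sum_sum_mul_add_half (x : ι → ι → ℝ) :
    ∑ i, ∑ j, x i j ^ 2 = (∑ i, ∑ j, x i j * x j i) + (1 / 2) * ∑ i, ∑ j, (x i j - x j i) ^ 2 := by
  have hswap : ∑ i, ∑ j, x j i ^ 2 = ∑ i, ∑ j, x i j ^ 2 := Finset.sum_comm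
  have hexp : ∑ i, ∑ j, (x i j - x j i) ^ 2 =
      (∑ i, ∑ j, x i j ^ 2) + (∑ i, ∑ j, x j i ^ 2) - 2 * ∑ i, ∑ j, x i j * x j i := by
    have h1 : ∀ i j, (x i j - x j i) ^ 2 = (x i j ^ 2 + x j i ^ 2) - 2 * (x i j * x j i) :=
      fun i j => by ring
    simp_rw [h1, Finset.sum_sub_distrib, Finset.sum_add_distrib, ← Finset.mul_sum]
  rw [hexp, hswap]
  ring

/-- **`|L|²_F = tr (L ∘ L) + ½ Σᵢⱼ (⟪L bᵢ, bⱼ⟫ − ⟪L bⱼ, bᵢ⟫)²`** for every `L : E →L[ℝ] E` and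
every orthonormal basis `b` (the second term is `½ |L − Lᵀ|²_F`; on `ℝ³` it is `|curl|²`, cf. the
accepted `frobeniusNormSq_fderiv_eq_sq_norm_curl_add_trace`). [folklore] -/
theorem frobeniusNormSq_eq_trace_comp_add_half_sum (b : OrthonormalBasis ι ℝ E) (L : E →L[ℝ] E) :
    frobeniusNormSq L = traceCLM (L.comp L) +
      (1 / 2) * ∑ i, ∑ j, (⟪L (b i), b j⟫ - ⟪L (b j), b i⟫) ^ 2 := by
  rw [frobeniusNormSq_eq_sum b, traceCLM_eq_sum_inner b]
  simp only [ContinuousLinearMap.coe_comp, Function.comp_apply]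
  simp_rw [inner_apply_apply_eq_sum b L, ← b.sum_sq_inner_left (L (b _))]
  exact sum_sum_sq_eq_sum_sum_mul_add_half fun i j => ⟪L (b i), b j⟫

omit [FiniteDimensional ℝ E] in
/-- The antisymmetric part is nonnegative. [folklore] -/
theorem half_sum_sq_nonneg (b : OrthonormalBasis ι ℝ E) (L : E →L[ℝ] E) :
    0 ≤ (1 / 2) * ∑ i, ∑ j, (⟪L (b i), b j⟫ - ⟪L (b j), b i⟫) ^ 2 :=
  mul_nonneg (by norm_num) (Finset.sum_nonneg fun _ _ => Finset.sum_nonneg fun _ _ => sq_nonneg _)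

end Algebra

/-! ### Calculus of frame components -/

section Components

variable [MeasurableSpace E] [BorelSpace E]

omit [FiniteDimensional ℝ E] [MeasurableSpace E] [BorelSpace E] in
/-- `D⟪v, c⟫(x) h = ⟪Dv(x) h, c⟫`. [folklore] -/
theorem fderiv_inner_const_apply {v : E → E} {x : E} (hv : DifferentiableAt ℝ v x) (c h : E) :
    fderiv ℝ (fun y => ⟪v y, c⟫) x h = ⟪fderiv ℝ v x h, c⟫ := by
  rw [fderiv_inner_apply ℝ hv (differentiableAt_const c)]
  simp

omit [FiniteDimensional ℝ E] [MeasurableSpace E] [BorelSpace E] in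
/-- Components of a `Cⁿ` field are `Cⁿ`. [folklore] -/
theorem contDiff_inner_const {v : E → E} {n : WithTop ℕ∞} (hv : ContDiff ℝ n v) (c : E) :
    ContDiff ℝ n fun y => ⟪v y, c⟫ :=
  hv.inner ℝ contDiff_const

/-- **Second integration by parts in the `div`–`curl` identity.** For a `C²` divergence-free
field `v` and a compactly supported `ψ ∈ C²`,
`∫ Dψ ((v·∇)v) = -∫ Σᵢⱼ (D²ψ bⱼ bᵢ) vᵢ vⱼ` (`vᵢ = ⟪v, bᵢ⟫`): write `Dψ((v·∇)v) = Σᵢⱼ ∂ᵢψ vⱼ ∂ⱼvᵢ`,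
move `∂ⱼ` onto `∂ᵢψ vⱼ`, and use `Σⱼ ∂ⱼvⱼ = div v = 0`. [folklore] -/
theorem integral_fderiv_apply_fderiv_self_eq (b : OrthonormalBasis ι ℝ E) {v : E → E}
    (hv : ContDiff ℝ 2 v) (hdiv : VectorCalculus.IsDivFree v) {ψ : E → ℝ} (hψ : ContDiff ℝ 2 ψ)
    (hψc : HasCompactSupport ψ) :
    ∫ x, fderiv ℝ ψ x (fderiv ℝ v x (v x)) =
      -∫ x, ∑ i, ∑ j, fderiv ℝ (fderiv ℝ ψ) x (b j) (b i) * (⟪v x, b i⟫ * ⟪v x, b j⟫) := by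
  have hv1 : ContDiff ℝ 1 v := hv.of_le one_le_two
  have hvd : ∀ x, DifferentiableAt ℝ v x := fun x => hv1.differentiable one_ne_zero x
  have hV1 : ∀ i, ContDiff ℝ 1 fun y => ⟪v y, b i⟫ := fun i => contDiff_inner_const hv1 (b i)
  have hVd : ∀ i x, DifferentiableAt ℝ (fun y => ⟪v y, b i⟫) x := fun i x =>
    (hV1 i).differentiable one_ne_zero x
  have hP1 : ∀ i, ContDiff ℝ 1 fun y => fderiv ℝ ψ y (b i) := fun i =>
    (hψ.fderiv_right (m := 1) le_rfl).clm_apply contDiff_const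
  have hPd : ∀ i x, DifferentiableAt ℝ (fun y => fderiv ℝ ψ y (b i)) x := fun i x =>
    (hP1 i).differentiable one_ne_zero x
  have hPc : ∀ i, HasCompactSupport fun y => fderiv ℝ ψ y (b i) := fun i =>
    hψc.fderiv_apply (𝕜 := ℝ) (b i)
  have hDV : ∀ i x h, fderiv ℝ (fun y => ⟪v y, b i⟫) x h = ⟪fderiv ℝ v x h, b i⟫ := fun i x h =>
    fderiv_inner_const_apply (hvd x) (b i) h
  have hDP : ∀ i j x, fderiv ℝ (fun y => fderiv ℝ ψ y (b i)) x (b j) =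
      fderiv ℝ (fderiv ℝ ψ) x (b j) (b i) := fun i j x => by
    rw [fderiv_fderiv_apply_eq hψ x (b i)]
    exact hψ.contDiffAt.isSymmSndFDerivAt (by simp) (b i) (b j)
  -- (1) the integrand in the frame
  have hexp : ∀ x, fderiv ℝ ψ x (fderiv ℝ v x (v x)) =
      ∑ i, ∑ j, fderiv ℝ ψ x (b i) * (⟪v x, b j⟫ * fderiv ℝ (fun y => ⟪v y, b i⟫) x (b j)) := by
    intro x
    have h1 : fderiv ℝ ψ x (fderiv ℝ v x (v x)) =
        ∑ i, ⟪b i, fderiv ℝ v x (v x)⟫ * fderiv ℝ ψ x (b i) := by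
      conv_lhs => rw [← b.sum_repr' (fderiv ℝ v x (v x)), map_sum]
      exact Finset.sum_congr rfl fun i _ => by rw [map_smul, smul_eq_mul]
    have h2 : ∀ i, ⟪b i, fderiv ℝ v x (v x)⟫ = ∑ j, ⟪v x, b j⟫ * ⟪fderiv ℝ v x (b j), b i⟫ := by
      intro i
      conv_lhs => rw [← b.sum_repr' (v x), map_sum, inner_sum]
      exact Finset.sum_congr rfl fun j _ => by
        rw [map_smul, inner_smul_right, real_inner_comm (b j), real_inner_comm (b i)]
    rw [h1]
    refine Finset.sum_congr rfl fun i _ => ?_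
    rw [h2 i, Finset.sum_mul]
    refine Finset.sum_congr rfl fun j _ => ?_
    rw [hDV i x (b j)]
    ring
  -- integrability of the pieces
  have iT : ∀ i j, Integrable (fun x => fderiv ℝ ψ x (b i) *
      (⟪v x, b j⟫ * fderiv ℝ (fun y => ⟪v y, b i⟫) x (b j))) volume := fun i j =>
    ((hP1 i).continuous.mul ((hV1 j).continuous.mul
      (((hV1 i).continuous_fderiv one_ne_zero).clm_apply continuous_const)))
      |>.integrable_of_hasCompactSupport (hPc i).mul_right
  have iA : ∀ i j, Integrable (fun x => fderiv ℝ (fun y => fderiv ℝ ψ y (b i)) x (b j) *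
      (⟪v x, b i⟫ * ⟪v x, b j⟫)) volume := fun i j =>
    ((((hP1 i).continuous_fderiv one_ne_zero).clm_apply continuous_const).mul
      ((hV1 i).continuous.mul (hV1 j).continuous)).integrable_of_hasCompactSupport
      ((hPc i).fderiv_apply (𝕜 := ℝ) (b j)).mul_right
  have iB : ∀ i j, Integrable (fun x => fderiv ℝ ψ x (b i) * ⟪v x, b i⟫ *
      fderiv ℝ (fun y => ⟪v y, b j⟫) x (b j)) volume := fun i j =>
    (((hP1 i).continuous.mul (hV1 i).continuous).mul
      (((hV1 j).continuous_fderiv one_ne_zero).clm_apply continuous_const))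
      |>.integrable_of_hasCompactSupport ((hPc i).mul_right).mul_right
  -- (2) one integration by parts in direction `b j`
  have hibp : ∀ i j, ∫ x, fderiv ℝ ψ x (b i) * (⟪v x, b j⟫ * fderiv ℝ (fun y => ⟪v y, b i⟫) x (b j)) =
      -((∫ x, fderiv ℝ (fun y => fderiv ℝ ψ y (b i)) x (b j) * (⟪v x, b i⟫ * ⟪v x, b j⟫)) +
        ∫ x, fderiv ℝ ψ x (b i) * ⟪v x, b i⟫ * fderiv ℝ (fun y => ⟪v y, b j⟫) x (b j)) := by
    intro i j
    have hk : ContDiff ℝ 1 fun y => fderiv ℝ ψ y (b i) * ⟪v y, b j⟫ := (hP1 i).mul (hV1 j)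
    have hkc : HasCompactSupport fun y => fderiv ℝ ψ y (b i) * ⟪v y, b j⟫ := (hPc i).mul_right
    have h := integral_mul_fderiv_apply_eq_neg (hV1 i) hk hkc (b j)
    -- `h : ∫ vᵢ ∂ⱼ(ψᵢ vⱼ) = -∫ ∂ⱼvᵢ (ψᵢ vⱼ)`
    have h1 : ∫ x, fderiv ℝ ψ x (b i) * (⟪v x, b j⟫ * fderiv ℝ (fun y => ⟪v y, b i⟫) x (b j)) =
        ∫ x, fderiv ℝ (fun y => ⟪v y, b i⟫) x (b j) * (fderiv ℝ ψ x (b i) * ⟪v x, b j⟫) :=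
      integral_congr_ae (ae_of_all _ fun x => by ring)
    have h2 : ∀ x, ⟪v x, b i⟫ * fderiv ℝ (fun y => fderiv ℝ ψ y (b i) * ⟪v y, b j⟫) x (b j) =
        fderiv ℝ (fun y => fderiv ℝ ψ y (b i)) x (b j) * (⟪v x, b i⟫ * ⟪v x, b j⟫) +
          fderiv ℝ ψ x (b i) * ⟪v x, b i⟫ * fderiv ℝ (fun y => ⟪v y, b j⟫) x (b j) := by
      intro x
      rw [fderiv_fun_mul (hPd i x) (hVd j x)]
      simp only [_root_.add_apply, _root_.FunLike.coe_smul, Pi.smul_apply, smul_eq_mul]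
      ring
    rw [h1, ← integral_add (iA i j) (iB i j), ← integral_neg]
    have h3 : ∫ x, fderiv ℝ (fun y => ⟪v y, b i⟫) x (b j) * (fderiv ℝ ψ x (b i) * ⟪v x, b j⟫) =
        -∫ x, ⟪v x, b i⟫ * fderiv ℝ (fun y => fderiv ℝ ψ y (b i) * ⟪v y, b j⟫) x (b j) := by
      linarith
    rw [h3, ← integral_neg]
    exact integral_congr_ae (ae_of_all _ fun x => by dsimp only; rw [h2 x])
  -- (3) `Σⱼ ψᵢ vᵢ ∂ⱼvⱼ = ψᵢ vᵢ div v = 0`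
  have hdiv0 : ∀ i x, ∑ j, fderiv ℝ ψ x (b i) * ⟪v x, b i⟫ * fderiv ℝ (fun y => ⟪v y, b j⟫) x (b j)
      = 0 := by
    intro i x
    rw [← Finset.mul_sum]
    have : ∑ j, fderiv ℝ (fun y => ⟪v y, b j⟫) x (b j) = VectorCalculus.divergence v x := by
      rw [divergence_eq_sum_inner_fderiv b]
      exact Finset.sum_congr rfl fun j _ => by rw [hDV j x (b j), real_inner_comm]
    rw [this, hdiv x, mul_zero]
  -- assemble
  calc ∫ x, fderiv ℝ ψ x (fderiv ℝ v x (v x))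
      = ∫ x, ∑ i, ∑ j, fderiv ℝ ψ x (b i) *
          (⟪v x, b j⟫ * fderiv ℝ (fun y => ⟪v y, b i⟫) x (b j)) :=
        integral_congr_ae (ae_of_all _ hexp)
    _ = ∑ i, ∑ j, ∫ x, fderiv ℝ ψ x (b i) *
          (⟪v x, b j⟫ * fderiv ℝ (fun y => ⟪v y, b i⟫) x (b j)) := by
        rw [integral_finsetSum _ fun i _ => integrable_finsetSum _ fun j _ => iT i j]
        exact Finset.sum_congr rfl fun i _ => integral_finsetSum _ fun j _ => iT i j
    _ = ∑ i, ∑ j, -((∫ x, fderiv ℝ (fun y => fderiv ℝ ψ y (b i)) x (b j) *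
          (⟪v x, b i⟫ * ⟪v x, b j⟫)) +
        ∫ x, fderiv ℝ ψ x (b i) * ⟪v x, b i⟫ * fderiv ℝ (fun y => ⟪v y, b j⟫) x (b j)) :=
        Finset.sum_congr rfl fun i _ => Finset.sum_congr rfl fun j _ => hibp i j
    _ = -(∑ i, ∑ j, ∫ x, fderiv ℝ (fun y => fderiv ℝ ψ y (b i)) x (b j) *
          (⟪v x, b i⟫ * ⟪v x, b j⟫)) -
        ∑ i, ∑ j, ∫ x, fderiv ℝ ψ x (b i) * ⟪v x, b i⟫ *
          fderiv ℝ (fun y => ⟪v y, b j⟫) x (b j) := by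
        simp only [neg_add, Finset.sum_add_distrib, Finset.sum_neg_distrib, sub_eq_add_neg]
    _ = -(∑ i, ∑ j, ∫ x, fderiv ℝ (fun y => fderiv ℝ ψ y (b i)) x (b j) *
          (⟪v x, b i⟫ * ⟪v x, b j⟫)) := by
        have h0 : ∀ i, ∑ j, ∫ x, fderiv ℝ ψ x (b i) * ⟪v x, b i⟫ *
            fderiv ℝ (fun y => ⟪v y, b j⟫) x (b j) = 0 := fun i => by
          rw [← integral_finsetSum _ fun j _ => iB i j]
          simp only [hdiv0, integral_zero]
        simp only [h0, Finset.sum_const_zero, sub_zero]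
    _ = -∫ x, ∑ i, ∑ j, fderiv ℝ (fderiv ℝ ψ) x (b j) (b i) * (⟪v x, b i⟫ * ⟪v x, b j⟫) := by
        have iA' : ∀ i j, Integrable (fun x => fderiv ℝ (fderiv ℝ ψ) x (b j) (b i) *
            (⟪v x, b i⟫ * ⟪v x, b j⟫)) volume := fun i j => by
          simpa only [hDP] using iA i j
        rw [integral_finsetSum _ fun i _ => integrable_finsetSum _ fun j _ => iA' i j]
        congr 1
        refine Finset.sum_congr rfl fun i _ => ?_
        rw [integral_finsetSum _ fun j _ => iA' i j]
        exact Finset.sum_congr rfl fun j _ => integral_congr_ae (ae_of_all _ fun x => by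
          simp only [hDP])

end Components

/-! ### Exhaustion with a vanishing error -/

section Exhaustion

variable [MeasurableSpace E] [BorelSpace E]

/-- **Exhaustion.** If a continuous `S ≥ 0` satisfies `∫ χ_R S ≤ M + g(R)` for all large `R`
with `g(R) → 0`, then `∫ S ≤ M` as a lower Lebesgue integral (monotone convergence over the balls
`B(0, n)`, on which `χ_R = 1` for `R ≥ n`; variant of the accepted
`lintegral_ofReal_le_of_forall_integral_cutoff_pow_mul_le`, error `γ/R`). [folklore] -/
theorem lintegral_ofReal_le_of_forall_integral_cutoff_mul_le {S : E → ℝ} (hS : Continuous S)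
    (hS0 : ∀ x, 0 ≤ S x) {M R₀ : ℝ} {g : ℝ → ℝ} (hg : Tendsto g atTop (𝓝 0))
    (h : ∀ R, R₀ ≤ R → ∫ x, cutoff R x * S x ≤ M + g R) :
    ∫⁻ x, ENNReal.ofReal (S x) ≤ ENNReal.ofReal M := by
  have hdir : Directed (· ⊆ ·) fun n : ℕ => Metric.ball (0 : E) n :=
    Monotone.directed_le fun a b hab => Metric.ball_subset_ball (by exact_mod_cast hab)
  have hlim : Tendsto (fun R : ℝ => ENNReal.ofReal (M + g R)) atTop (𝓝 (ENNReal.ofReal M)) := by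
    refine (ENNReal.continuous_ofReal.tendsto M).comp ?_
    simpa using (tendsto_const_nhds (x := M)).add hg
  calc ∫⁻ x, ENNReal.ofReal (S x)
      = ∫⁻ x in ⋃ n : ℕ, Metric.ball (0 : E) n, ENNReal.ofReal (S x) := by
        rw [Metric.iUnion_ball_nat, Measure.restrict_univ]
    _ = ⨆ n : ℕ, ∫⁻ x in Metric.ball (0 : E) n, ENNReal.ofReal (S x) :=
        setLIntegral_iUnion_of_directed _ hdir
    _ ≤ ENNReal.ofReal M := iSup_le fun n => ?_
  refine le_of_tendsto_of_tendsto tendsto_const_nhds hlim ?_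
  filter_upwards [eventually_ge_atTop R₀, eventually_ge_atTop (n : ℝ), eventually_gt_atTop 0]
    with R hR hRn hR0
  have hint : Integrable fun x => cutoff R x * S x :=
    ((contDiff_cutoff (n := 1) R).continuous.mul hS).integrable_of_hasCompactSupport
      (hasCompactSupport_cutoff hR0).mul_right
  calc ∫⁻ x in Metric.ball (0 : E) n, ENNReal.ofReal (S x)
      ≤ ∫⁻ x in Metric.ball (0 : E) n, ENNReal.ofReal (cutoff R x * S x) := by
        refine setLIntegral_mono' measurableSet_ball fun x hx => le_of_eq ?_
        rw [cutoff_eq_one hR0 ((mem_ball_zero_iff.1 hx).le.trans hRn), one_mul]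
    _ ≤ ∫⁻ x, ENNReal.ofReal (cutoff R x * S x) := setLIntegral_le_lintegral _ _
    _ = ENNReal.ofReal (∫ x, cutoff R x * S x) :=
        (ofReal_integral_eq_lintegral_ofReal hint (ae_of_all _ fun x =>
          mul_nonneg (cutoff_nonneg R x) (hS0 x))).symm
    _ ≤ ENNReal.ofReal (M + g R) := ENNReal.ofReal_le_ofReal (h R hR)

end Exhaustion

/-! ### Second derivatives of the cut-off: size `C/R²`, support in `|x| ≤ 2R` -/

section Cutoff

variable [MeasurableSpace E] [BorelSpace E]

omit [MeasurableSpace E] [BorelSpace E] in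
/-- **Second derivatives of the cut-off**: there is `C ≥ 0` with
`‖D²χ_R(x)‖ ≤ (C/R²)·1_{|x| ≤ 2R}` for all `R > 0`. [folklore] -/
theorem exists_norm_fderiv_fderiv_cutoff_le_indicator :
    ∃ C : ℝ, 0 ≤ C ∧ ∀ R : ℝ, 0 < R → ∀ x : E,
      ‖fderiv ℝ (fderiv ℝ (cutoff R)) x‖ ≤
        C / R ^ 2 * (closedBall (0 : E) (2 * R)).indicator (fun _ => (1 : ℝ)) x := by
  obtain ⟨C, hC, h⟩ := exists_norm_fderiv_fderiv_cutoff_le (E := E)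
  refine ⟨C, hC, fun R hR x => ?_⟩
  by_cases hx : x ∈ closedBall (0 : E) (2 * R)
  · rw [indicator_of_mem hx, mul_one]; exact h R hR x
  · rw [indicator_of_notMem hx, mul_zero]
    have hx' : x ∉ tsupport (fderiv ℝ (fderiv ℝ (cutoff (E := E) R))) := fun h' =>
      hx (tsupport_cutoff_subset hR (tsupport_fderiv_subset ℝ (tsupport_fderiv_subset ℝ h')))
    have h0 : fderiv ℝ (fderiv ℝ (cutoff (E := E) R)) x = 0 :=
      image_eq_zero_of_notMem_tsupport hx'
    rw [h0]
    exact le_of_eq (@norm_zero (E →L[ℝ] E →L[ℝ] ℝ) _)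

end Cutoff

/-! ### The `div`–`curl` estimate for smooth divergence-free fields in `L² + L⁴`, `dim E = 3` -/

section Estimate

variable [MeasurableSpace E] [BorelSpace E]

omit [FiniteDimensional ℝ E] [MeasurableSpace E] [BorelSpace E] in
/-- Pointwise bound for the error integrand:
`|Σᵢⱼ (D²ψ bⱼ bᵢ) vᵢ vⱼ| ≤ (card ι)² ‖D²ψ‖ ‖v‖²`. [folklore] -/
theorem abs_sum_sum_fderiv_fderiv_mul_le (b : OrthonormalBasis ι ℝ E) (ψ : E → ℝ) (v : E → E)
    (x : E) :
    |∑ i, ∑ j, fderiv ℝ (fderiv ℝ ψ) x (b j) (b i) * (⟪v x, b i⟫ * ⟪v x, b j⟫)| ≤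
      (Fintype.card ι : ℝ) ^ 2 * (‖fderiv ℝ (fderiv ℝ ψ) x‖ * ‖v x‖ ^ 2) := by
  have hb : ∀ i, ‖b i‖ = 1 := fun i => b.orthonormal.1 i
  have hterm : ∀ i j, |fderiv ℝ (fderiv ℝ ψ) x (b j) (b i) * (⟪v x, b i⟫ * ⟪v x, b j⟫)| ≤
      ‖fderiv ℝ (fderiv ℝ ψ) x‖ * ‖v x‖ ^ 2 := by
    intro i j
    rw [abs_mul, abs_mul]
    have h1 : |fderiv ℝ (fderiv ℝ ψ) x (b j) (b i)| ≤ ‖fderiv ℝ (fderiv ℝ ψ) x‖ := by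
      rw [← Real.norm_eq_abs]
      calc ‖fderiv ℝ (fderiv ℝ ψ) x (b j) (b i)‖
          ≤ ‖fderiv ℝ (fderiv ℝ ψ) x (b j)‖ * ‖b i‖ := ContinuousLinearMap.le_opNorm _ _
        _ ≤ ‖fderiv ℝ (fderiv ℝ ψ) x‖ * ‖b j‖ * ‖b i‖ :=
            mul_le_mul_of_nonneg_right (ContinuousLinearMap.le_opNorm _ _) (norm_nonneg _)
        _ = ‖fderiv ℝ (fderiv ℝ ψ) x‖ := by rw [hb, hb, mul_one, mul_one]
    have h2 : |⟪v x, b i⟫| ≤ ‖v x‖ := by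
      simpa [hb] using abs_real_inner_le_norm (v x) (b i)
    have h3 : |⟪v x, b j⟫| ≤ ‖v x‖ := by
      simpa [hb] using abs_real_inner_le_norm (v x) (b j)
    calc |fderiv ℝ (fderiv ℝ ψ) x (b j) (b i)| * (|⟪v x, b i⟫| * |⟪v x, b j⟫|)
        ≤ ‖fderiv ℝ (fderiv ℝ ψ) x‖ * (‖v x‖ * ‖v x‖) :=
          mul_le_mul h1 (mul_le_mul h2 h3 (abs_nonneg _) (norm_nonneg _))
            (mul_nonneg (abs_nonneg _) (abs_nonneg _)) (norm_nonneg (fderiv ℝ (fderiv ℝ ψ) x))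
      _ = ‖fderiv ℝ (fderiv ℝ ψ) x‖ * ‖v x‖ ^ 2 := by ring
  calc |∑ i, ∑ j, fderiv ℝ (fderiv ℝ ψ) x (b j) (b i) * (⟪v x, b i⟫ * ⟪v x, b j⟫)|
      ≤ ∑ i, |∑ j, fderiv ℝ (fderiv ℝ ψ) x (b j) (b i) * (⟪v x, b i⟫ * ⟪v x, b j⟫)| :=
        Finset.abs_sum_le_sum_abs _ _
    _ ≤ ∑ i, ∑ j, |fderiv ℝ (fderiv ℝ ψ) x (b j) (b i) * (⟪v x, b i⟫ * ⟪v x, b j⟫)| :=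
        Finset.sum_le_sum fun i _ => Finset.abs_sum_le_sum_abs _ _
    _ ≤ ∑ _i : ι, ∑ _j : ι, ‖fderiv ℝ (fderiv ℝ ψ) x‖ * ‖v x‖ ^ 2 :=
        Finset.sum_le_sum fun i _ => Finset.sum_le_sum fun j _ => hterm i j
    _ = (Fintype.card ι : ℝ) ^ 2 * (‖fderiv ℝ (fderiv ℝ ψ) x‖ * ‖v x‖ ^ 2) := by
        simp only [Finset.sum_const, Finset.card_univ, nsmul_eq_mul]; ring

omit [NormedAddCommGroup E] [InnerProductSpace ℝ E] [FiniteDimensional ℝ E] [MeasurableSpace E]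
  [BorelSpace E] in
/-- Young's inequality with a parameter: `1_B a ≤ ½ (ε a² + ε⁻¹ 1_B)` for real `a` and `ε > 0`
(`1_B ∈ {0,1}`). [folklore] -/
theorem indicator_mul_le_half {s : Set E} {x : E} {a ε : ℝ} (hε : 0 < ε) :
    s.indicator (fun _ => (1 : ℝ)) x * a ≤
      (1 / 2) * (ε * a ^ 2 + ε⁻¹ * s.indicator (fun _ => (1 : ℝ)) x) := by
  by_cases hx : x ∈ s
  · rw [indicator_of_mem hx, one_mul, mul_one]
    have h1 : 2 * a ≤ ε * a ^ 2 + ε⁻¹ := by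
      have h := sq_nonneg (ε * a - 1)
      have hε' : ε⁻¹ * (ε * a - 1) ^ 2 = ε * a ^ 2 - 2 * a + ε⁻¹ := by
        field_simp; ring
      nlinarith [mul_nonneg (inv_nonneg.2 hε.le) h]
    linarith
  · rw [indicator_of_notMem hx, zero_mul, mul_zero, add_zero]
    positivity

/-- **The `div`–`curl` energy estimate in dimension `3`.** Let `E` be a real inner product space
with `finrank ℝ E = 3`, `b` an orthonormal basis, and `v ∈ C²(E; E)` divergence free with
`v = h + k`, `h ∈ L²`, `k ∈ L⁴`. Then
`∫⁻ |Dv|²_F ≤ ∫⁻ ½ Σᵢⱼ (⟪Dv bᵢ, bⱼ⟫ − ⟪Dv bⱼ, bᵢ⟫)²` in `[0, ∞]`: the weighted identity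
`∫ χ_R |Dv|² = ∫ χ_R (½ Σ…) + ∫ Σᵢⱼ (∂ⱼ∂ᵢχ_R) vᵢ vⱼ` (pointwise algebra, `div v = 0`, two
integrations by parts), the error bound
`(card ι)² (C/R²) ∫_{|x|≤2R} |v|² ≤ (card ι)² C (4‖h‖₂²/R² + (‖k‖₄⁴ + 8|B₁|) R^{-1/2})` (Young with
parameter `ε = R√R` and `|B_{2R}| = 8R³|B₁|`), and exhaustion `R → ∞`. No integrability of `Dv`
and no square integrability of `v` are assumed. [folklore] -/
theorem lintegral_frobeniusNormSq_fderiv_le_of_memLp_two_add_four (h3 : finrank ℝ E = 3)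
    (b : OrthonormalBasis ι ℝ E) {v h k : E → E} (hv : ContDiff ℝ 2 v) (hdiv : VectorCalculus.IsDivFree v)
    (hvhk : v = h + k) (hh : MemLp h 2 volume) (hk : MemLp k 4 volume) :
    ∫⁻ x, ENNReal.ofReal (frobeniusNormSq (fderiv ℝ v x)) ≤
      ∫⁻ x, ENNReal.ofReal ((1 / 2) * ∑ i, ∑ j,
        (⟪fderiv ℝ v x (b i), b j⟫ - ⟪fderiv ℝ v x (b j), b i⟫) ^ 2) := by
  -- the antisymmetric density `W` and the full density `S`
  set W : E → ℝ := fun x => (1 / 2) * ∑ i, ∑ j,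
    (⟪fderiv ℝ v x (b i), b j⟫ - ⟪fderiv ℝ v x (b j), b i⟫) ^ 2 with hWdef
  set S : E → ℝ := fun x => frobeniusNormSq (fderiv ℝ v x) with hSdef
  by_cases hΩ : ∫⁻ x, ENNReal.ofReal (W x) = ⊤
  · rw [hΩ]; exact le_top
  have hv1 : ContDiff ℝ 1 v := hv.of_le one_le_two
  have hDc : Continuous (fderiv ℝ v) := hv1.continuous_fderiv one_ne_zero
  have hW0 : ∀ x, 0 ≤ W x := fun x => half_sum_sq_nonneg b _
  have hS0 : ∀ x, 0 ≤ S x := fun x => frobeniusNormSq_nonneg _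
  have hWc : Continuous W := by
    refine continuous_const.mul (continuous_finsetSum _ fun i _ => continuous_finsetSum _
      fun j _ => ?_)
    exact (((hDc.clm_apply continuous_const).inner continuous_const).sub
      ((hDc.clm_apply continuous_const).inner continuous_const)).pow 2
  have hSc : Continuous S := continuous_frobeniusNormSq_fderiv hv (by simp)
  have hWi : Integrable W := by
    refine ⟨hWc.aestronglyMeasurable, ?_⟩
    have : ∫⁻ x, ‖W x‖ₑ = ∫⁻ x, ENNReal.ofReal (W x) :=
      lintegral_congr fun x => by rw [Real.enorm_eq_ofReal (hW0 x)]
    rw [HasFiniteIntegral, this]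
    exact lt_top_iff_ne_top.2 hΩ
  set Ω : ℝ := ∫ x, W x with hΩdef
  have hΩeq : ∫⁻ x, ENNReal.ofReal (W x) = ENNReal.ofReal Ω :=
    (ofReal_integral_eq_lintegral_ofReal hWi (ae_of_all _ hW0)).symm
  rw [hΩeq]
  -- norms of the data
  have hh2 : Integrable (fun x => ‖h x‖ ^ 2) := (memLp_two_iff_integrable_sq_norm hh.1).1 hh
  have hk4 : Integrable (fun x => ‖k x‖ ^ 4) := by
    have hk' : MemLp k ((4 : ℕ) : ℝ≥0∞) volume := by simpa using hk
    exact hk'.integrable_norm_pow (by norm_num)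
  set N : ℝ := ∫ x, ‖h x‖ ^ 2 with hNdef
  set A : ℝ := ∫ x, ‖k x‖ ^ 4 with hAdef
  set V₁ : ℝ := volume.real (closedBall (0 : E) 1) with hV₁def
  have hN0 : 0 ≤ N := integral_nonneg fun x => by positivity
  have hA0 : 0 ≤ A := integral_nonneg fun x => by positivity
  have hV₁0 : 0 ≤ V₁ := measureReal_nonneg
  obtain ⟨C, hC0, hC⟩ := exists_norm_fderiv_fderiv_cutoff_le_indicator (E := E)
  set c₀ : ℝ := (Fintype.card ι : ℝ) ^ 2 with hc₀def
  have hc₀0 : 0 ≤ c₀ := by positivity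
  -- the error function
  set g : ℝ → ℝ := fun R => c₀ * C * (4 * N / R ^ 2 + (A + 8 * V₁) * (Real.sqrt R / R)) with hgdef
  have hg : Tendsto g atTop (𝓝 0) := by
    have h1 : Tendsto (fun R : ℝ => 4 * N / R ^ 2) atTop (𝓝 0) :=
      tendsto_const_nhds.div_atTop (tendsto_pow_atTop two_ne_zero)
    have h2 : Tendsto (fun R : ℝ => Real.sqrt R / R) atTop (𝓝 0) := by
      refine (tendsto_rpow_neg_atTop (by norm_num : (0 : ℝ) < 1 / 2)).congr' ?_
      filter_upwards [eventually_gt_atTop 0] with R hR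
      rw [Real.sqrt_eq_rpow, show (-(1 / 2 : ℝ)) = 1 / 2 - 1 by norm_num, Real.rpow_sub hR,
        Real.rpow_one]
    have h3 := (h1.add (h2.const_mul (A + 8 * V₁))).const_mul (c₀ * C)
    simpa [hgdef] using h3
  -- the bound for a fixed `R ≥ 1`
  have key : ∀ R, (1 : ℝ) ≤ R → ∫ x, cutoff R x * S x ≤ Ω + g R := by
    intro R hR
    have hR0 : 0 < R := one_pos.trans_le hR
    set ψ : E → ℝ := cutoff R with hψdef
    have hψ : ContDiff ℝ 2 ψ := contDiff_cutoff R
    have hψ1 : ContDiff ℝ 1 ψ := contDiff_cutoff R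
    have hψc : HasCompactSupport ψ := hasCompactSupport_cutoff hR0
    -- (a) `∫ ψ S = ∫ ψ tr(Dv∘Dv) + ∫ ψ W`
    have hsplit : ∀ x, ψ x * S x =
        ψ x * traceCLM ((fderiv ℝ v x).comp (fderiv ℝ v x)) + ψ x * W x := fun x => by
      rw [hSdef, hWdef]; dsimp only
      rw [frobeniusNormSq_eq_trace_comp_add_half_sum b]; ring
    have iTr : Integrable fun x => ψ x * traceCLM ((fderiv ℝ v x).comp (fderiv ℝ v x)) := by
      refine (hψ.continuous.mul (traceCLM.continuous.comp ?_)).integrable_of_hasCompactSupport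
        hψc.mul_right
      exact ((ContinuousLinearMap.compL ℝ E E E).continuous₂).comp (hDc.prodMk hDc)
    have iW : Integrable fun x => ψ x * W x :=
      (hψ.continuous.mul hWc).integrable_of_hasCompactSupport hψc.mul_right
    -- (b) the trace term: first IBP (accepted) and `div v = 0`
    have htr : ∫ x, ψ x * traceCLM ((fderiv ℝ v x).comp (fderiv ℝ v x)) =
        -∫ x, fderiv ℝ ψ x (fderiv ℝ v x (v x)) := by
      have h := integral_mul_trace_comp_sub_divergence_sq hv hψ1 hψc
      simp_rw [hdiv _, zero_smul, sub_zero, sq, mul_zero, sub_zero] at h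
      exact h
    -- (c) second IBP
    have hibp := integral_fderiv_apply_fderiv_self_eq b hv hdiv hψ hψc
    -- (d) the error bound
    set I : E → ℝ := fun x => ∑ i, ∑ j,
      fderiv ℝ (fderiv ℝ ψ) x (b j) (b i) * (⟪v x, b i⟫ * ⟪v x, b j⟫) with hIdef
    set ε : ℝ := R * Real.sqrt R with hεdef
    have hsq0 : 0 < Real.sqrt R := Real.sqrt_pos.2 hR0
    have hε : 0 < ε := mul_pos hR0 hsq0
    set B : Set E := closedBall (0 : E) (2 * R) with hBdef
    have hBm : MeasurableSet B := measurableSet_closedBall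
    have hBvol : volume.real B = 8 * R ^ 3 * V₁ := by
      rw [hBdef, Measure.addHaar_real_closedBall' volume (0 : E) (by positivity), h3, hV₁def]
      ring
    have hBfin : volume B ≠ ⊤ := measure_closedBall_lt_top.ne
    have iInd : Integrable (B.indicator fun _ => (1 : ℝ)) volume :=
      (integrable_indicator_iff hBm).2 (integrableOn_const (C := (1 : ℝ)) hBfin)
    have hmaj : ∀ x, |I x| ≤ c₀ * (C / R ^ 2) *
        (2 * ‖h x‖ ^ 2 + (ε * ‖k x‖ ^ 4 + ε⁻¹ * B.indicator (fun _ => (1 : ℝ)) x)) := by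
      intro x
      refine (abs_sum_sum_fderiv_fderiv_mul_le b ψ v x).trans ?_
      rw [mul_assoc (c₀)]
      refine mul_le_mul_of_nonneg_left ?_ hc₀0
      have hD := hC R hR0 x
      have hind0 : 0 ≤ B.indicator (fun _ => (1 : ℝ)) x := indicator_nonneg (fun _ _ => zero_le_one) x
      have hind1 : B.indicator (fun _ => (1 : ℝ)) x ≤ 1 :=
        indicator_le_self' (fun _ _ => zero_le_one) x |>.trans le_rfl
      have hvx : ‖v x‖ ^ 2 ≤ 2 * ‖h x‖ ^ 2 + 2 * ‖k x‖ ^ 2 := by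
        have : v x = h x + k x := by rw [hvhk]; rfl
        rw [this]
        calc ‖h x + k x‖ ^ 2 ≤ (‖h x‖ + ‖k x‖) ^ 2 :=
              pow_le_pow_left₀ (norm_nonneg _) (norm_add_le _ _) 2
          _ ≤ 2 * ‖h x‖ ^ 2 + 2 * ‖k x‖ ^ 2 := by nlinarith [sq_nonneg (‖h x‖ - ‖k x‖)]
      have hY : B.indicator (fun _ => (1 : ℝ)) x * ‖k x‖ ^ 2 ≤
          (1 / 2) * (ε * (‖k x‖ ^ 2) ^ 2 + ε⁻¹ * B.indicator (fun _ => (1 : ℝ)) x) :=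
        indicator_mul_le_half hε
      have hCR : 0 ≤ C / R ^ 2 := by positivity
      calc ‖fderiv ℝ (fderiv ℝ ψ) x‖ * ‖v x‖ ^ 2
          ≤ C / R ^ 2 * B.indicator (fun _ => (1 : ℝ)) x * ‖v x‖ ^ 2 :=
            mul_le_mul_of_nonneg_right hD (sq_nonneg _)
        _ ≤ C / R ^ 2 * B.indicator (fun _ => (1 : ℝ)) x * (2 * ‖h x‖ ^ 2 + 2 * ‖k x‖ ^ 2) :=
            mul_le_mul_of_nonneg_left hvx (mul_nonneg hCR hind0)
        _ = C / R ^ 2 * (B.indicator (fun _ => (1 : ℝ)) x * (2 * ‖h x‖ ^ 2) +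
              2 * (B.indicator (fun _ => (1 : ℝ)) x * ‖k x‖ ^ 2)) := by ring
        _ ≤ C / R ^ 2 * (2 * ‖h x‖ ^ 2 +
              2 * ((1 / 2) * (ε * (‖k x‖ ^ 2) ^ 2 + ε⁻¹ * B.indicator (fun _ => (1 : ℝ)) x))) := by
            refine mul_le_mul_of_nonneg_left (add_le_add ?_ ?_) hCR
            · calc B.indicator (fun _ => (1 : ℝ)) x * (2 * ‖h x‖ ^ 2)
                  ≤ 1 * (2 * ‖h x‖ ^ 2) := mul_le_mul_of_nonneg_right hind1 (by positivity)
                _ = 2 * ‖h x‖ ^ 2 := one_mul _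
            · exact mul_le_mul_of_nonneg_left hY (by norm_num)
        _ = C / R ^ 2 * (2 * ‖h x‖ ^ 2 + (ε * ‖k x‖ ^ 4 + ε⁻¹ * B.indicator (fun _ => (1 : ℝ)) x)) := by
            ring
    have iMaj : Integrable (fun x => c₀ * (C / R ^ 2) *
        (2 * ‖h x‖ ^ 2 + (ε * ‖k x‖ ^ 4 + ε⁻¹ * B.indicator (fun _ => (1 : ℝ)) x))) volume :=
      ((hh2.const_mul 2).add ((hk4.const_mul ε).add (iInd.const_mul _))).const_mul _
    have iI : Integrable I volume := by
      have hψ2c : Continuous (fderiv ℝ (fderiv ℝ ψ)) :=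
        (hψ.fderiv_right (m := 1) le_rfl).continuous_fderiv one_ne_zero
      refine Continuous.integrable_of_hasCompactSupport ?_ ?_
      · refine continuous_finsetSum _ fun i _ => continuous_finsetSum _ fun j _ => ?_
        exact ((hψ2c.clm_apply continuous_const).clm_apply continuous_const).mul
          ((hv.continuous.inner continuous_const).mul (hv.continuous.inner continuous_const))
      · refine (hψc.fderiv (𝕜 := ℝ)).fderiv (𝕜 := ℝ) |>.mono ?_
        intro x hx
        rw [mem_support] at hx ⊢
        contrapose! hx
        simp only [hIdef, hx, zero_apply, zero_mul, Finset.sum_const_zero]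
    have herr : |∫ x, I x| ≤ g R := by
      calc |∫ x, I x| ≤ ∫ x, |I x| := abs_integral_le_integral_abs
        _ ≤ ∫ x, c₀ * (C / R ^ 2) *
            (2 * ‖h x‖ ^ 2 + (ε * ‖k x‖ ^ 4 + ε⁻¹ * B.indicator (fun _ => (1 : ℝ)) x)) :=
            integral_mono iI.abs iMaj hmaj
        _ = c₀ * (C / R ^ 2) * (2 * N + (ε * A + ε⁻¹ * (8 * R ^ 3 * V₁))) := by
            have i1 : Integrable (fun x => 2 * ‖h x‖ ^ 2) volume := hh2.const_mul 2
            have i2 : Integrable (fun x => ε * ‖k x‖ ^ 4) volume := hk4.const_mul ε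
            have i3 : Integrable (fun x => ε⁻¹ * B.indicator (fun _ => (1 : ℝ)) x) volume :=
              iInd.const_mul _
            have i23 : Integrable (fun x => ε * ‖k x‖ ^ 4 +
                ε⁻¹ * B.indicator (fun _ => (1 : ℝ)) x) volume := i2.add i3
            rw [integral_const_mul, integral_add i1 i23, integral_add i2 i3, integral_const_mul,
              integral_const_mul, integral_const_mul, integral_indicator_const (1 : ℝ) hBm, smul_eq_mul,
              mul_one, hBvol]
        _ ≤ g R := by
            rw [hgdef]; dsimp only
            -- `ε = R √R`: `ε/R² = √R/R`, `ε⁻¹ 8R³/R² = 8√R/R`, and `2N ≤ 4N`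
            have hRR : Real.sqrt R * Real.sqrt R = R := Real.mul_self_sqrt hR0.le
            have hεinv : ε⁻¹ * (8 * R ^ 3 * V₁) = 8 * V₁ * (R * Real.sqrt R) := by
              rw [hεdef]; field_simp; nlinarith [hRR]
            rw [hεinv, hεdef]
            have hfrac : c₀ * (C / R ^ 2) * (2 * N + (R * Real.sqrt R * A + 8 * V₁ * (R * Real.sqrt R)))
                = c₀ * C * (2 * N / R ^ 2 + (A + 8 * V₁) * (Real.sqrt R / R)) := by
              field_simp
            rw [hfrac]
            have : 2 * N / R ^ 2 ≤ 4 * N / R ^ 2 := by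
              apply div_le_div_of_nonneg_right _ (by positivity); linarith
            nlinarith [mul_nonneg hc₀0 hC0]
    -- (e) assemble: `∫ ψ S = ∫ ψ W + ∫ I ≤ Ω + g R`
    have hmain : ∫ x, ψ x * W x ≤ Ω := by
      refine integral_mono iW hWi fun x => ?_
      have h1 := cutoff_le_one R x
      have h0 := cutoff_nonneg R x
      have := hW0 x
      nlinarith
    calc ∫ x, cutoff R x * S x = ∫ x, (ψ x * traceCLM ((fderiv ℝ v x).comp (fderiv ℝ v x)) +
          ψ x * W x) := integral_congr_ae (ae_of_all _ hsplit)
      _ = (∫ x, I x) + ∫ x, ψ x * W x := by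
          rw [integral_add iTr iW, htr, hibp, neg_neg]
      _ ≤ g R + Ω := add_le_add ((le_abs_self _).trans herr) hmain
      _ = Ω + g R := add_comm _ _
  exact lintegral_ofReal_le_of_forall_integral_cutoff_mul_le hSc hS0 hg key

end Estimate

end Literature.Analysis.FluidPDE
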